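import Summits.FinalStateConjecture.FinalStateConjecture.Theorems.EIHFluxBalanceInertialRecessionLorentz
import Mathlib.Analysis.Calculus.ContDiff.Bounds
import Mathlib.Analysis.SpecialFunctions.Sqrt

/-!
# Route EIHFluxBalance — `InertialRecession`: the lab velocity of a painted 4-velocity (smoothness, bounds)

Helper file for the crux `stmt-FinalStateConjecture-10166`
(`Summit.FinalStateConjecture.FinalStateConjecture.Theses.EIHFluxBalance.InertialRecession`).

A line's slaving statement controls the painted 4-velocities `uᵢ(t) = Λᵢ(t)e₀ ∈ E4` (lab-time
derivatives tending to `0`), while the flat-chart estimate for Schwarzschild holes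
(`tendsto_deviationCk_flat_of_ansatz_schwarzschild'`, file `…FlatChartSchwarzschild`) consumes the
LAB VELOCITIES `vᵢ = ũᵢ/uᵢ⁰ ∈ E3` with a speed bound `κ₀ < 1` and bounded derivatives. This file
is the bridge: the map `G(u) = (u⁰)⁻¹ ũ` is smooth on `{u⁰ ≠ 0}` (`contDiffAt_labVelocityMap`), so
`t ↦ G(u(t))` is smooth (`contDiff_labVelocity`); its derivatives of orders `1 … k` are bounded in
terms of those of `u` uniformly on the compact set `{1 ≤ u⁰, ‖u‖ ≤ C}`
(`exists_bound_iteratedDeriv_labVelocity'`, Faà di Bruno + continuity on a compact set); the relation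
`ũ = u⁰ • G(u)` (`spatial_eq_smul_labVelocity`); and the speed bound from the Lorentz factor,
`‖v‖² ≤ 1 − γ⁻²` for `u = Λe₀` with `0 < u⁰ ≤ γ` (`norm_labVelocity_sq_le`,
`norm_labVelocity_le_sqrt`), with `√(1 − γ⁻²) < 1`.
-/

noncomputable section

open Literature.Geometry.Lorentzian Set Filter Function Metric
open scoped ContDiff Topology

namespace Summit.FinalStateConjecture.FinalStateConjecture.Theorems

/-- The lab-velocity map `G(u) = (u⁰)⁻¹ ũ` is smooth where `u⁰ ≠ 0`. [folklore] -/
theorem contDiffAt_labVelocityMap {u : E4} (hu : u 0 ≠ 0) {n : WithTop ℕ∞} :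
    ContDiffAt ℝ n (fun w : E4 ↦ (w 0)⁻¹ • E4.spatial w) u := by
  have h0 : ContDiffAt ℝ n (fun w : E4 ↦ w 0) u :=
    (EuclideanSpace.proj (0 : Fin 4) : E4 →L[ℝ] ℝ).contDiff.contDiffAt
  exact (h0.inv hu).smul E4.spatial.contDiff.contDiffAt

/-- The lab velocity of a smooth 4-velocity path with `u⁰ ≠ 0` is smooth. [folklore] -/
theorem contDiff_labVelocity {w : ℝ → E4} {n : WithTop ℕ∞} (hw : ContDiff ℝ n w)
    (hw0 : ∀ s, w s 0 ≠ 0) : ContDiff ℝ n fun s ↦ ((w s) 0)⁻¹ • E4.spatial (w s) :=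
  contDiff_iff_contDiffAt.mpr fun s ↦ (contDiffAt_labVelocityMap (hw0 s)).comp s hw.contDiffAt

/-- `ũ = u⁰ • G(u)` for `u⁰ ≠ 0` (the relation `(Λe₀)~ = (Λe₀)⁰ v` consumed by the flat-chart
estimate). [folklore] -/
theorem spatial_eq_smul_labVelocity {u : E4} (hu : u 0 ≠ 0) :
    E4.spatial u = (u 0) • ((u 0)⁻¹ • E4.spatial u) := by
  rw [smul_smul, mul_inv_cancel₀ hu, one_smul]

/-- **Speed bound from the Lorentz factor**: for `u = Λe₀` with `0 < u⁰ ≤ γ`,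
`‖(u⁰)⁻¹ ũ‖² ≤ 1 − (γ²)⁻¹` (`(u⁰)² = 1 + ‖ũ‖²`). O'Neill 1983, Ch. 9, p. 233. [folklore] -/
theorem norm_labVelocity_sq_le (Λ : lorentzGroup) {γ : ℝ}
    (h0 : 0 < ((Λ : E4 ≃L[ℝ] E4) (E4.basisVector 0)) 0)
    (hγ : ((Λ : E4 ≃L[ℝ] E4) (E4.basisVector 0)) 0 ≤ γ) :
    ‖((((Λ : E4 ≃L[ℝ] E4) (E4.basisVector 0)) 0)⁻¹ •
      E4.spatial ((Λ : E4 ≃L[ℝ] E4) (E4.basisVector 0)))‖ ^ 2 ≤ 1 - (γ ^ 2)⁻¹ := by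
  have hsq := lorentz_apply_zero_sq Λ
  generalize hu0 : ((Λ : E4 ≃L[ℝ] E4) (E4.basisVector 0)) 0 = u0 at hsq h0 hγ ⊢
  generalize hs : E4.spatialNorm ((Λ : E4 ≃L[ℝ] E4) (E4.basisVector 0)) = sn at hsq
  have hsn : ‖E4.spatial ((Λ : E4 ≃L[ℝ] E4) (E4.basisVector 0))‖ = sn := hs
  rw [norm_smul, norm_inv, Real.norm_of_nonneg h0.le, hsn, mul_pow, inv_pow]
  have hγ0 : 0 < γ := h0.trans_le hγ
  have h1 : (u0 ^ 2)⁻¹ * sn ^ 2 = 1 - (u0 ^ 2)⁻¹ := by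
    have : u0 ≠ 0 := h0.ne'
    field_simp
    linarith
  have h2 : (γ ^ 2)⁻¹ ≤ (u0 ^ 2)⁻¹ := by
    apply inv_anti₀ (by positivity)
    exact pow_le_pow_left₀ h0.le hγ 2
  rw [h1]
  linarith

/-- The speed bound as a norm bound: `‖v‖ ≤ √(1 − (γ²)⁻¹)`, and `√(1 − (γ²)⁻¹) < 1` (bookkeeping
for the hypothesis `κ₀ < 1`). [folklore] -/
theorem norm_labVelocity_le_sqrt (Λ : lorentzGroup) {γ : ℝ}
    (h0 : 0 < ((Λ : E4 ≃L[ℝ] E4) (E4.basisVector 0)) 0)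
    (hγ : ((Λ : E4 ≃L[ℝ] E4) (E4.basisVector 0)) 0 ≤ γ) :
    ‖((((Λ : E4 ≃L[ℝ] E4) (E4.basisVector 0)) 0)⁻¹ •
      E4.spatial ((Λ : E4 ≃L[ℝ] E4) (E4.basisVector 0)))‖ ≤ Real.sqrt (1 - (γ ^ 2)⁻¹) ∧
      Real.sqrt (1 - (γ ^ 2)⁻¹) < 1 := by
  refine ⟨Real.le_sqrt_of_sq_le (norm_labVelocity_sq_le Λ h0 hγ), ?_⟩
  have hγ0 : 0 < γ := h0.trans_le hγ
  rw [Real.sqrt_lt' one_pos, one_pow]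
  have : 0 < (γ ^ 2)⁻¹ := by positivity
  linarith

-- operator/vector-valued multilinear maps: the instance path is slow
set_option synthInstance.maxHeartbeats 200000 in
/-- **Derivatives of the lab velocity are bounded by those of the 4-velocity.** For every order
`k`, size `C` and bound `Γ` there is `Γ'` such that for every `Cᵏ` path `w : ℝ → E4` with
`1 ≤ w(s)⁰` and `‖w(s)‖ ≤ C` for all `s`, and `‖w⁽ʲ⁾(t)‖ ≤ Γ` for `1 ≤ j ≤ k`:
`‖(s ↦ (w(s)⁰)⁻¹ w(s)~)⁽ʲ⁾(t)‖ ≤ Γ'` for `1 ≤ j ≤ k` (Faà di Bruno, with the derivatives of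
`G(u) = (u⁰)⁻¹ũ` bounded on the compact set `{1 ≤ u⁰, ‖u‖ ≤ C}` by continuity). [folklore] -/
theorem exists_bound_iteratedDeriv_labVelocity' (k : ℕ) (C Γ : ℝ) :
    ∃ Γ' : ℝ, ∀ (w : ℝ → E4) (t : ℝ), ContDiff ℝ k w → (∀ s, 1 ≤ w s 0) → (∀ s, ‖w s‖ ≤ C) →
      (∀ j, 1 ≤ j → j ≤ k → ‖iteratedDeriv j w t‖ ≤ Γ) →
      ∀ j, 1 ≤ j → j ≤ k → ‖iteratedDeriv j (fun s ↦ ((w s) 0)⁻¹ • E4.spatial (w s)) t‖ ≤ Γ' := by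
  set G : E4 → E3 := fun u ↦ (u 0)⁻¹ • E4.spatial u with hG
  set O : Set E4 := {u | 1 / 2 < u 0} with hO
  have hc0 : Continuous fun u : E4 ↦ u 0 := PiLp.continuous_apply 2 _ 0
  have hOo : IsOpen O := isOpen_lt continuous_const hc0
  have hGc : ContDiffOn ℝ ∞ G O := fun u hu ↦
    (contDiffAt_labVelocityMap (by change 1 / 2 < u 0 at hu; linarith)).contDiffWithinAt
  set K : Set E4 := {u | 1 ≤ u 0} ∩ closedBall 0 C with hK
  have hKc : IsCompact K :=
    (isCompact_closedBall _ _).inter_left (isClosed_le continuous_const hc0)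
  have hKO : K ⊆ O := fun u hu ↦ by
    change 1 / 2 < u 0
    have : 1 ≤ u 0 := hu.1
    linarith
  have hbound : ∀ i : ℕ, ∃ B : ℝ, ∀ u ∈ K, ‖iteratedFDeriv ℝ i G u‖ ≤ B := by
    intro i
    have h1 := hGc.continuousOn_iteratedFDerivWithin (m := i) (by exact_mod_cast le_top)
      hOo.uniqueDiffOn
    have h2 := h1.congr (g := iteratedFDeriv ℝ i G)
      fun p hp ↦ (iteratedFDerivWithin_of_isOpen i hOo hp).symm
    obtain ⟨B, hB⟩ := hKc.exists_bound_of_continuousOn (h2.mono hKO)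
    exact ⟨B, hB⟩
  choose B hB using hbound
  set Bmax : ℝ := ∑ i ∈ Finset.range (k + 1), |B i| with hBmax
  have hBi : ∀ i ≤ k, ∀ u ∈ K, ‖iteratedFDeriv ℝ i G u‖ ≤ Bmax :=
    fun i hi u hu ↦ ((hB i u hu).trans (le_abs_self _)).trans
      (Finset.single_le_sum (f := fun i ↦ |B i|) (fun _ _ ↦ abs_nonneg _)
        (Finset.mem_range.mpr (Nat.lt_succ_of_le hi)))
  set D : ℝ := max Γ 1 with hD
  refine ⟨(k.factorial : ℝ) * Bmax * D ^ k, fun w t hw hw1 hwC hwb j hj1 hj ↦ ?_⟩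
  have hBmax0 : 0 ≤ Bmax := Finset.sum_nonneg fun _ _ ↦ abs_nonneg _
  have hD1 : 1 ≤ D := le_max_right _ _
  have hwt : w t ∈ K := ⟨hw1 t, by simpa using hwC t⟩
  set s : Set ℝ := w ⁻¹' O with hs
  have hso : IsOpen s := hOo.preimage hw.continuous
  have hts : t ∈ s := hKO hwt
  have hcomp := norm_iteratedFDerivWithin_comp_le (g := G) (f := w) (n := j)
    (N := ((k : ℕ∞) : WithTop ℕ∞)) (x := t) (hGc.of_le (by exact_mod_cast le_top)) hw.contDiffOn
    (by exact_mod_cast hj) hOo.uniqueDiffOn hso.uniqueDiffOn (fun y hy ↦ hy) hts (C := Bmax) (D := D)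
    (fun i hi ↦ by
      rw [iteratedFDerivWithin_of_isOpen i hOo (hKO hwt)]
      exact hBi i (hi.trans hj) (w t) hwt)
    (fun i hi1 hij ↦ by
      rw [iteratedFDerivWithin_of_isOpen i hso hts, norm_iteratedFDeriv_eq_norm_iteratedDeriv]
      exact ((hwb i hi1 (hij.trans hj)).trans (le_max_left _ _)).trans
        (le_self_pow₀ hD1 (by omega)))
  rw [iteratedFDerivWithin_of_isOpen j hso hts] at hcomp
  rw [← norm_iteratedFDeriv_eq_norm_iteratedDeriv]
  refine hcomp.trans ?_
  have h1 : (j.factorial : ℝ) ≤ k.factorial := by exact_mod_cast Nat.factorial_le hj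
  have h2 : D ^ j ≤ D ^ k := pow_le_pow_right₀ hD1 hj
  exact mul_le_mul (mul_le_mul_of_nonneg_right h1 hBmax0) h2 (by positivity) (by positivity)

/-- Registered sub-goal form (stub `exists_bound_iteratedDeriv_labVelocity` of the crux item) of
`exists_bound_iteratedDeriv_labVelocity'`. [folklore] -/
theorem exists_bound_iteratedDeriv_labVelocity : ∀ (k : ℕ) (C Γ : ℝ), ∃ Γ' : ℝ, ∀ (w : ℝ → E4) (t : ℝ), ContDiff ℝ k w → (∀ s, 1 ≤ w s 0) → (∀ s, ‖w s‖ ≤ C) → (∀ j, 1 ≤ j → j ≤ k → ‖iteratedDeriv j w t‖ ≤ Γ) → ∀ j, 1 ≤ j → j ≤ k → ‖iteratedDeriv j (fun s ↦ ((w s) 0)⁻¹ • E4.spatial (w s)) t‖ ≤ Γ' :=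
  exists_bound_iteratedDeriv_labVelocity'

end Summit.FinalStateConjecture.FinalStateConjecture.Theorems

end
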